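import Literature.Analysis.PDE.MeasureValuedWeakStrong

/-!
# PF persistence, fake seat 1 — LEMMA F1-K: no positive smoothing twin (PROVED)

Unit `pub-rhpf-fake-1` of the `pub-rhpf` cell (mechanism / rigidity campaign; **no RH claims**);
companion of `HOME/FAKES.md §1.8.4`.  Nothing here mentions `ζ`: the lemma is the elementary
measure-theoretic core of LEMMA F1-K, stated for an arbitrary probability measure on `ℝ`.

Context (informal, FAKES §1.8): a depth-`U` twin of `ζ` whose critical measure is a SMOOTHING
`K ∗ μ_Z` of `ζ`'s zero measure by a kernel `K` must have `K̂ ≡ 1` on `(−log U, log U)` (locality,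
LEMMA F1-Z).  THEOREM F1-S identifies the PNT-continued template twin `T_∅⁺(U)` as exactly such a
smoothing, with the (signed) Dirichlet kernel `sin(Lt)/(πt)`, `L = log U`.  The lemma below says that
NO POSITIVE kernel can do this job except `δ₀`: a probability measure `K` on `ℝ` with
`∫ cos (x t) dK(t) = 1` for all `0 < x < L` is the Dirac mass at `0`.  Hence a smoothing twin is
Weil-positive only if it has `ζ`'s spectral measure (FAKES §1.8.4, LEMMA F1-K).

Uses the folklore `Literature.Analysis.PDE.ConservationLaw.eq_dirac_of_ae_eq` (a probability measure
a.e. equal to a point is the Dirac mass).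

* `ae_cos_eq_one_of_integral_eq_one` — `∫ cos (x t) dK = 1` forces `cos (x t) = 1` for `K`-a.e. `t`;
* `ae_eq_zero_of_cos_integral_eq_one` — the cosine condition on `(0, L)` forces `t = 0` `K`-a.e.;
* `eq_dirac_of_cos_integral_eq_one` — LEMMA F1-K: such a `K` is `Measure.dirac 0`.
-/

set_option linter.dupNamespace false

noncomputable section

open MeasureTheory Set Filter

namespace Summit.RiemannHypothesis.RiemannHypothesis.Theorems.PfPersistence.Fake1.Smoothing

/-- For a probability measure `K` on `ℝ` and a real `x`, `∫ cos (x t) dK(t) = 1` forces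
`cos (x t) = 1` for `K`-a.e. `t` (the integrand `1 - cos (x t)` is nonnegative with integral `0`). -/
theorem ae_cos_eq_one_of_integral_eq_one (K : Measure ℝ) [IsProbabilityMeasure K] (x : ℝ)
    (h : ∫ t, Real.cos (x * t) ∂K = 1) : ∀ᵐ t ∂K, Real.cos (x * t) = 1 := by
  have hcos_int : Integrable (fun t : ℝ => Real.cos (x * t)) K := by
    refine Integrable.mono' (integrable_const (1 : ℝ)) ?_ (Eventually.of_forall fun t => ?_)
    · exact (Real.continuous_cos.comp (continuous_const.mul continuous_id)).aestronglyMeasurable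
    · simpa using Real.abs_cos_le_one (x * t)
  have hf_int : Integrable (fun t : ℝ => 1 - Real.cos (x * t)) K :=
    (integrable_const (1 : ℝ)).sub hcos_int
  have hf_nonneg : 0 ≤ᵐ[K] fun t : ℝ => 1 - Real.cos (x * t) :=
    Eventually.of_forall fun t => by
      have := Real.cos_le_one (x * t)
      simp only [Pi.zero_apply]
      linarith
  have hf_zero : ∫ t, (1 - Real.cos (x * t)) ∂K = 0 := by
    rw [integral_sub (integrable_const (1 : ℝ)) hcos_int, h]
    simp
  have hae := (integral_eq_zero_iff_of_nonneg_ae hf_nonneg hf_int).1 hf_zero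
  filter_upwards [hae] with t ht
  have ht' : 1 - Real.cos (x * t) = 0 := by simpa using ht
  linarith

/-- If `∫ cos (x t) dK(t) = 1` for every `x ∈ (0, L)` (`L > 0`), then `t = 0` for `K`-a.e. `t`:
test with the countable family `x_n = L / (n + 2)`; for fixed `t ≠ 0` and `n` large, `|x_n t| < 2π`
and `cos (x_n t) = 1` force `x_n t = 0`. -/
theorem ae_eq_zero_of_cos_integral_eq_one (K : Measure ℝ) [IsProbabilityMeasure K] {L : ℝ}
    (hL : 0 < L) (h : ∀ x : ℝ, 0 < x → x < L → ∫ t, Real.cos (x * t) ∂K = 1) :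
    ∀ᵐ t ∂K, t = 0 := by
  have hx : ∀ n : ℕ, 0 < L / (n + 2) ∧ L / (n + 2) < L := fun n => by
    have hn : (1 : ℝ) < (n : ℝ) + 2 := by
      have : (0 : ℝ) ≤ n := Nat.cast_nonneg n
      linarith
    exact ⟨div_pos hL (by linarith), div_lt_self hL hn⟩
  have hall : ∀ᵐ t ∂K, ∀ n : ℕ, Real.cos (L / (n + 2) * t) = 1 :=
    ae_all_iff.2 fun n => ae_cos_eq_one_of_integral_eq_one K _ (h _ (hx n).1 (hx n).2)
  filter_upwards [hall] with t ht
  obtain ⟨n, hn⟩ := exists_nat_gt (L * |t| / (2 * Real.pi))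
  have hπ : 0 < Real.pi := Real.pi_pos
  have hn2 : (0 : ℝ) < (n : ℝ) + 2 := by
    have : (0 : ℝ) ≤ n := Nat.cast_nonneg n
    linarith
  -- `|L/(n+2) * t| < 2π`
  have hbound : |L / (n + 2) * t| < 2 * Real.pi := by
    rw [abs_mul, abs_of_pos (hx n).1, div_mul_eq_mul_div, div_lt_iff₀ hn2]
    have h1 : L * |t| < (n : ℝ) * (2 * Real.pi) := by
      have := (div_lt_iff₀ (by positivity : (0 : ℝ) < 2 * Real.pi)).1 hn
      linarith
    nlinarith
  have hlt := abs_lt.1 hbound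
  have hzero : L / (n + 2) * t = 0 :=
    (Real.cos_eq_one_iff_of_lt_of_lt hlt.1 hlt.2).1 (ht n)
  rcases mul_eq_zero.1 hzero with h0 | h0
  · exact absurd h0 (hx n).1.ne'
  · exact h0

/-- **LEMMA F1-K** (FAKES §1.8.4; mechanism/rigidity campaign, no RH claims): a probability
measure on `ℝ` whose cosine transform is identically `1` on an interval `(0, L)`, `L > 0`, is the
Dirac mass at `0`.  (A positive smoothing kernel reproducing a measure's Fourier transform on a
neighbourhood of `0` is trivial.) -/
theorem eq_dirac_of_cos_integral_eq_one (K : Measure ℝ) [IsProbabilityMeasure K] {L : ℝ}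
    (hL : 0 < L) (h : ∀ x : ℝ, 0 < x → x < L → ∫ t, Real.cos (x * t) ∂K = 1) :
    K = Measure.dirac 0 :=
  Literature.Analysis.PDE.ConservationLaw.eq_dirac_of_ae_eq
    (ae_eq_zero_of_cos_integral_eq_one K hL h)

end Summit.RiemannHypothesis.RiemannHypothesis.Theorems.PfPersistence.Fake1.Smoothing
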